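import Literature.NumberTheory.LFunctions.MertensConjectureDisproofNumericsProofs
import Literature.NumberTheory.LFunctions.Brent1979Reduction
import HarnessLib

/-!
# The Riemann hypothesis up to height `2516`: `N(2516) = N₀(2516) = 2000`, all zeros simple
# (from the tree's certified Odlyzko–te Riele computation)

Topic `Literature/NumberTheory/LFunctions` (trunk T-ANT with T-VALNUM). Pure proof file: nothing is
asserted. The tree's certified recomputation of the `2000` zeros of Odlyzko–te Riele
(`MertensCertificate.lean`; compiled block evaluations `MertensCertificate/Chunk00–19.lean`,
`Top.lean`; re-read at the explicit height `T₀ = 2516` as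
`Literature.NumberTheory.LFunctions.MertensTable3.certificate_heightT0`,
`MertensConjectureDisproofNumericsProofs.lean`) locates `N(2516)` distinct ordinates `0 < γ < 2516`
of zeros of `ζ` on the critical line, where `N(2516) = 2000` by the winding certificate along
`[½, 2] × {2516}` (`ZetaNumerics.Mertens.zetaZeroCount_of_checkTop`). Brent's `H(n)` criterion
(`Literature.NumberTheory.LFunctions.simple_onLine_upTo_of_located_zeros`, `Brent1979Reduction.lean`:
`N` counts multiplicity, so the located zeros exhaust it) then gives, with no further computation:

* `zeros_simple_onLine_upTo_2516` — every zero `ρ` of `ζ` with `0 < Im ρ ≤ 2516` has `Re ρ = ½`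
  and is simple;
* `riemannHypothesisUpTo_2516 : RiemannHypothesisUpTo 2516` (the named hypothesis of
  `NamedHypotheses.lean`), `riemannHypothesisInStripUpTo_2516` (two-sided strip form);
* `zetaZeroCount_2516 : N(2516) = 2000`, `criticalZeroCount_2516 : N₀(2516) = 2000`.

This raises the height to which RH is certified *inside the tree* from `101` (`29` zeros, kernel
only: `riemannHypothesisUpTo_hundredOne`, `RiemannHypothesisUpTo101.lean`) to `2516` (`2000` zeros),
at the price of the compiled evaluations' auxiliary axioms (below); the `2000` zeros are those of
Odlyzko–te Riele, §4.2 (p. 151), certified afresh by the tree's own evaluator.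

## Axioms

Every theorem of this file depends on `propext`, `Classical.choice`, `Quot.sound` and on the `22`
`native_decide` auxiliary axioms of `MertensCertificate.ZetaNumerics.Mertens.checkChunk_00` …
`checkChunk_19`, `checkTop_holds`, `checkFinal_holds` (trust in the Lean compiler, the
`Lean.ofReduceBool` family), exactly as `OdlyzkoTeRiele1985_numerics_holds`
(`RHWave0MertensProofs.lean`) and `OdlyzkoTeRiele1985_table3_holds` — the printed source is itself a
machine computation (§4.2–4.4). Proposal flag `computational`.

## References

* A. M. Odlyzko, H. J. J. te Riele, *Disproof of the Mertens conjecture*, J. reine angew. Math.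
  357 (1985), 138–160, §4.1 (4.1) p. 150, §4.2 p. 151 (the `2000` zeros). [OdlyzkoTeRiele1985]
* R. P. Brent, *On the zeros of the Riemann zeta function in the critical strip*, Math. Comp. 33
  (1979), 1361–1372, §4 (`N(g_n) = n + 1 ⇒ H(n + 1)`). [Brent1979]
* E. C. Titchmarsh, *The Theory of the Riemann Zeta-Function*, 2nd ed. 1986, §15.3 (history of
  the computations). [Titchmarsh1986]
-/

noncomputable section

open Complex

namespace Literature.NumberTheory.LFunctions

open ZetaNumerics.Mertens MertensCertificate.ZetaNumerics.Mertens

/-- **The zeros of `ζ` up to height `2516` are simple and on the critical line, and there are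
`2000` of them**: packed form `(∀ ρ, ζ ρ = 0 → 0 < Im ρ ≤ 2516 → Re ρ = ½ ∧ ζ'(ρ) ≠ 0) ∧
N(2516) = 2000`, from `MertensTable3.certificate_heightT0` (the `N(2516)` located ordinates),
`zetaZeroCount_of_checkTop` (`N(2516) = 2000`) and Brent's criterion
`simple_onLine_upTo_of_located_zeros`.
[cite: OdlyzkoTeRiele1985, §4.2 p. 151] [cite: Brent1979, §4] -/
theorem zeros_simple_onLine_upTo_2516_pack :
    (∀ ρ : ℂ, riemannZeta ρ = 0 → 0 < ρ.im → ρ.im ≤ 2516 →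
        ρ.re = 1 / 2 ∧ deriv riemannZeta ρ ≠ 0) ∧ zetaZeroCount 2516 = 2000 := by
  classical
  obtain ⟨Z, hZ, hN, -, -⟩ := MertensTable3.certificate_heightT0
  rw [heightT0_real] at hZ hN
  have h2000 : zetaZeroCount (2516 : ℝ) = 2000 := by
    have := zetaZeroCount_of_checkTop checkTop_holds
    rwa [heightT0_real] at this
  have h := simple_onLine_upTo_of_located_zeros (T := 2516) Z
    (fun γ hγ => ⟨(hZ γ hγ).1, (hZ γ hγ).2.1, (hZ γ hγ).2.2.le⟩) hN.le
  exact ⟨fun ρ hρ h0 hT => ⟨(h.1 ρ hρ h0 hT).1, (h.1 ρ hρ h0 hT).2.1⟩, h2000⟩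

/-- **Every zero `ρ` of `ζ` with `0 < Im ρ ≤ 2516` lies on the critical line and is simple**
(the first `2000` zeros, Odlyzko–te Riele §4.2, certified in the tree).
[cite: OdlyzkoTeRiele1985, §4.2 p. 151] [cite: Brent1979, §4] -/
theorem zeros_simple_onLine_upTo_2516 {ρ : ℂ} (hρ : riemannZeta ρ = 0) (h0 : 0 < ρ.im)
    (hT : ρ.im ≤ 2516) : ρ.re = 1 / 2 ∧ deriv riemannZeta ρ ≠ 0 :=
  zeros_simple_onLine_upTo_2516_pack.1 ρ hρ h0 hT

/-- **The Riemann hypothesis up to height `2516`** (the named hypothesis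
`Literature.NumberTheory.DiophantineGeometry.RiemannHypothesisUpTo` at `T = 2516`): every zero of
`ζ` with `0 < Im ρ ≤ 2516` has `Re ρ = ½`. [cite: OdlyzkoTeRiele1985, §4.2 p. 151] -/
theorem riemannHypothesisUpTo_2516 : DiophantineGeometry.RiemannHypothesisUpTo 2516 :=
  fun _ hρ h0 hT => (zeros_simple_onLine_upTo_2516 hρ h0 hT).1

/-- The two-sided strip form: every zero of `ζ` with `0 < Re ρ < 1` and `|Im ρ| ≤ 2516` has
`Re ρ = ½`. [cite: OdlyzkoTeRiele1985, §4.2 p. 151] -/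
theorem riemannHypothesisInStripUpTo_2516 : RiemannHypothesisInStripUpTo 2516 :=
  (riemannHypothesisInStripUpTo_iff_holds 2516).2 riemannHypothesisUpTo_2516

/-- `N(2516) = 2000`: `ζ` has exactly `2000` zeros with `0 < Im ρ ≤ 2516`, counted with
multiplicity (`γ₂₀₀₀ = 2515.28…`, `γ₂₀₀₁ > 2516`). [cite: OdlyzkoTeRiele1985, §4.1 (4.1) p. 150] -/
theorem zetaZeroCount_2516 : zetaZeroCount 2516 = 2000 :=
  zeros_simple_onLine_upTo_2516_pack.2

/-- `N₀(2516) = 2000`: all `2000` zeros up to height `2516` are on the critical line.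
[cite: OdlyzkoTeRiele1985, §4.2 p. 151] -/
theorem criticalZeroCount_2516 : criticalZeroCount 2516 = 2000 := by
  rw [← zetaZeroCount_2516]
  exact (DiophantineGeometry.riemannHypothesisUpTo_iff_criticalZeroCount_eq 2516).1
    riemannHypothesisUpTo_2516

/-- RH up to any height `T ≤ 2516`, e.g. for consumers stated at `T = 16`, `19`, `101`, `1000`
(antitonicity of `RiemannHypothesisUpTo`). [folklore] -/
theorem riemannHypothesisUpTo_of_le_2516 {T : ℝ} (hT : T ≤ 2516) :
    DiophantineGeometry.RiemannHypothesisUpTo T :=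
  DiophantineGeometry.riemannHypothesisUpTo_anti hT riemannHypothesisUpTo_2516

end Literature.NumberTheory.LFunctions
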